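import Mathlib.Analysis.SpecialFunctions.Sqrt
import Literature.Geometry.Lorentzian.MinkowskiRadialMultiplier

/-!
# Route ClusterCompleteness — crux `AdiabaticMultiKerrILED`, line `Sketch`: the flat Morawetz bulk

Helper file for the crux `stmt-FinalStateConjecture-14310`
(`Summit.FinalStateConjecture.FinalStateConjecture.Theses.ClusterCompleteness.AdiabaticMultiKerrILED`).

For every `R > 0` we construct the smooth lab-centred Keel–Smith–Sogge / Morawetz multiplier pair
on Minkowski space used in the exactly flat region between the holes (`stub_flatMorawetzBulk`):
with `s = |y⃗|²`, `q = √(s + R²)`, the vector field `X⁰ = 0`, `Xⁱ = g(s) yᵢ`, `g(s) = q⁻¹`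
(`X = f(r) ∂_r`, `f = r (r² + R²)^{-1/2}`, `|X| ≤ 1`) and the Lagrangian weight
`ϖ(s) = 4 q⁻¹ + R² q⁻³ = (4 s + 5 R²)(s + R²)^{-3/2} = 2 div X − R² g³`
(`|ϖ| (|y⃗| + R) ≤ 8`, `|∇ϖ| (|y⃗| + R)² ≤ 32`).
By `KerrSchild.multiplierBulk_eta_radial` (`K^X = 2g'(y⃗·p⃗)² + g|p⃗|² − ½(2sg' + 3g)Q`,
`Q = −p₀² + |p⃗|²`) and `KerrSchild.waveOperator_eta_radial` (`□_η φ(s) = 4 s φ'' + 6 φ'`), the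
modified bulk `K^X + ¼ ϖ Q − ⅛ (□_η ϖ) w²` of `KerrSchild.sum_fderiv_modifiedCurrent` equals
`q⁻³ ((s|p⃗|² − (y⃗·p⃗)²) + ¾ R² |p⃗|² + ¼ R² p₀²) + (R²/8) q⁻⁷ (6 s + 21 R²) w²`, hence is
`≥ ¼ R² q⁻³ ∑_μ p_μ²` everywhere (`bulk_lower_bound`; Cauchy–Schwarz `(y⃗·p⃗)² ≤ s |p⃗|²`), in
particular non-negative, and `≥ (32 R)⁻¹ ∑_μ p_μ²` on the lab ball `{|y⃗| ≤ R}` (`q ≤ 2R` there);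
multiplier folklore (Morawetz 1968; Dafermos–Rodnianski arXiv:0811.0354, §4.1). [folklore]
-/

noncomputable section

-- the doubled `FinalStateConjecture.FinalStateConjecture` path component trips dupNamespace
set_option linter.dupNamespace false

open scoped ContDiff Topology
open Filter Set Literature.Geometry.Lorentzian

namespace Summit.FinalStateConjecture.FinalStateConjecture.Cruxes.AdiabaticMultiKerrILED.Sketch

/-! ### One-variable calculus of the profiles `u ↦ (u + R²)^{-n/2}` -/

/-- `d/du [(√(u + R²))⁻ⁿ] = −(n/2) (√(u + R²))^{−n−2}` where `u + R² > 0`. [folklore] -/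
theorem hasDerivAt_inv_sqrt_pow (R : ℝ) (n : ℕ) {s : ℝ} (hs : 0 < s + R ^ 2) :
    HasDerivAt (fun u ↦ (Real.sqrt (u + R ^ 2) ^ n)⁻¹)
      (-(n / 2) * (Real.sqrt (s + R ^ 2) ^ (n + 2))⁻¹) s := by
  have hq : 0 < Real.sqrt (s + R ^ 2) := Real.sqrt_pos.mpr hs
  have hqne : Real.sqrt (s + R ^ 2) ≠ 0 := hq.ne'
  have h1 : HasDerivAt (fun u ↦ Real.sqrt (u + R ^ 2)) (1 / (2 * Real.sqrt (s + R ^ 2))) s :=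
    ((hasDerivAt_id s).add_const (R ^ 2)).sqrt hs.ne'
  have h2 : HasDerivAt (fun u ↦ (Real.sqrt (u + R ^ 2) ^ n)⁻¹)
      (-(↑n * Real.sqrt (s + R ^ 2) ^ (n - 1) * (1 / (2 * Real.sqrt (s + R ^ 2)))) /
        (Real.sqrt (s + R ^ 2) ^ n) ^ 2) s :=
    (h1.pow n).inv (pow_ne_zero n hqne)
  refine h2.congr_deriv ?_
  rcases n with _ | m
  · simp
  · rw [Nat.add_sub_cancel]
    push_cast
    field_simp
    ring

/-- The radial profile `g(u) = (u + R²)^{-1/2}` has `g'(u) = −½ (u + R²)^{-3/2}`. [folklore] -/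
theorem hasDerivAt_gProfile (R : ℝ) {s : ℝ} (hs : 0 < s + R ^ 2) :
    HasDerivAt (fun u ↦ (Real.sqrt (u + R ^ 2))⁻¹)
      (-(1 / 2) * (Real.sqrt (s + R ^ 2) ^ 3)⁻¹) s := by
  simpa using hasDerivAt_inv_sqrt_pow R 1 hs

/-- The weight `ϖ(u) = 4 (u + R²)^{-1/2} + R² (u + R²)^{-3/2}` has
`ϖ'(u) = −2 (u + R²)^{-3/2} − (3/2) R² (u + R²)^{-5/2}`. [folklore] -/
theorem hasDerivAt_weight (R : ℝ) {s : ℝ} (hs : 0 < s + R ^ 2) :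
    HasDerivAt (fun u ↦ 4 * (Real.sqrt (u + R ^ 2))⁻¹ + R ^ 2 * (Real.sqrt (u + R ^ 2) ^ 3)⁻¹)
      (-2 * (Real.sqrt (s + R ^ 2) ^ 3)⁻¹ - 3 / 2 * R ^ 2 * (Real.sqrt (s + R ^ 2) ^ 5)⁻¹) s := by
  have h1 := hasDerivAt_gProfile R hs
  have h3 := hasDerivAt_inv_sqrt_pow R 3 hs
  refine ((h1.const_mul 4).add (h3.const_mul (R ^ 2))).congr_deriv ?_
  push_cast
  ring

/-- The derivative of the weight, `ϖ'(u) = −2 (u + R²)^{-3/2} − (3/2) R² (u + R²)^{-5/2}`, has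
`ϖ''(u) = 3 (u + R²)^{-5/2} + (15/4) R² (u + R²)^{-7/2}`. [folklore] -/
theorem hasDerivAt_weight_deriv (R : ℝ) {s : ℝ} (hs : 0 < s + R ^ 2) :
    HasDerivAt
      (fun u ↦ -2 * (Real.sqrt (u + R ^ 2) ^ 3)⁻¹ - 3 / 2 * R ^ 2 * (Real.sqrt (u + R ^ 2) ^ 5)⁻¹)
      (3 * (Real.sqrt (s + R ^ 2) ^ 5)⁻¹ + 15 / 4 * R ^ 2 * (Real.sqrt (s + R ^ 2) ^ 7)⁻¹) s := by
  have h3 := hasDerivAt_inv_sqrt_pow R 3 hs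
  have h5 := hasDerivAt_inv_sqrt_pow R 5 hs
  refine ((h3.const_mul (-2)).sub (h5.const_mul (3 / 2 * R ^ 2))).congr_deriv ?_
  push_cast
  ring

/-- The weight `ϖ` is smooth where `u + R² > 0`. [folklore] -/
theorem contDiffAt_weight (R : ℝ) {n : WithTop ℕ∞} {s : ℝ} (hs : 0 < s + R ^ 2) :
    ContDiffAt ℝ n
      (fun u ↦ 4 * (Real.sqrt (u + R ^ 2))⁻¹ + R ^ 2 * (Real.sqrt (u + R ^ 2) ^ 3)⁻¹) s := by
  have h1 : ContDiffAt ℝ n (fun u ↦ Real.sqrt (u + R ^ 2)) s :=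
    (contDiffAt_id.add contDiffAt_const).sqrt hs.ne'
  have hne : Real.sqrt (s + R ^ 2) ≠ 0 := (Real.sqrt_pos.mpr hs).ne'
  exact (contDiffAt_const.mul (h1.inv hne)).add
    (contDiffAt_const.mul ((h1.pow 3).inv (pow_ne_zero 3 hne)))

/-- `deriv ϖ` at a point with `u + R² > 0`. [folklore] -/
theorem deriv_weight (R : ℝ) {s : ℝ} (hs : 0 < s + R ^ 2) :
    deriv (fun u ↦ 4 * (Real.sqrt (u + R ^ 2))⁻¹ + R ^ 2 * (Real.sqrt (u + R ^ 2) ^ 3)⁻¹) s =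
      -2 * (Real.sqrt (s + R ^ 2) ^ 3)⁻¹ - 3 / 2 * R ^ 2 * (Real.sqrt (s + R ^ 2) ^ 5)⁻¹ :=
  (hasDerivAt_weight R hs).deriv

/-- `deriv (deriv ϖ)` at a point with `u + R² > 0` (`deriv ϖ = ϖ'` on the open half-line
`{u > −R²}`). [folklore] -/
theorem deriv_deriv_weight (R : ℝ) {s : ℝ} (hs : 0 < s + R ^ 2) :
    deriv (deriv
        (fun u ↦ 4 * (Real.sqrt (u + R ^ 2))⁻¹ + R ^ 2 * (Real.sqrt (u + R ^ 2) ^ 3)⁻¹)) s =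
      3 * (Real.sqrt (s + R ^ 2) ^ 5)⁻¹ + 15 / 4 * R ^ 2 * (Real.sqrt (s + R ^ 2) ^ 7)⁻¹ := by
  have hev : deriv
      (fun u ↦ 4 * (Real.sqrt (u + R ^ 2))⁻¹ + R ^ 2 * (Real.sqrt (u + R ^ 2) ^ 3)⁻¹) =ᶠ[𝓝 s]
      fun u ↦ -2 * (Real.sqrt (u + R ^ 2) ^ 3)⁻¹ -
        3 / 2 * R ^ 2 * (Real.sqrt (u + R ^ 2) ^ 5)⁻¹ := by
    filter_upwards [Ioi_mem_nhds (show -R ^ 2 < s by linarith)] with u hu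
    rw [Set.mem_Ioi] at hu
    exact deriv_weight R (by linarith)
  rw [hev.deriv_eq]
  exact (hasDerivAt_weight_deriv R hs).deriv

/-! ### The multiplier pair on `E4`: smoothness and size -/

/-- `y ↦ |y⃗|²` is smooth on `E4` (a quadratic polynomial in the coordinates). [folklore] -/
theorem contDiff_spatialNormSq {n : WithTop ℕ∞} :
    ContDiff ℝ n (fun y : E4 ↦ E4.spatialNorm y ^ 2) := by
  have h : (fun y : E4 ↦ E4.spatialNorm y ^ 2) = fun y ↦ y 1 ^ 2 + y 2 ^ 2 + y 3 ^ 2 :=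
    funext E4.spatialNorm_sq
  rw [h]
  have hc : ∀ μ : Fin 4, ContDiff ℝ n (fun y : E4 ↦ y μ) := fun μ ↦ (E4.dx μ).contDiff
  exact (((hc 1).pow 2).add ((hc 2).pow 2)).add ((hc 3).pow 2)

/-- `y ↦ √(|y⃗|² + R²)` is smooth on `E4` for `R > 0`. [folklore] -/
theorem contDiff_sqrt_spatialNormSq_add {R : ℝ} (hR : 0 < R) {n : WithTop ℕ∞} :
    ContDiff ℝ n (fun y : E4 ↦ Real.sqrt (E4.spatialNorm y ^ 2 + R ^ 2)) :=
  (contDiff_spatialNormSq.add contDiff_const).sqrt fun y ↦ by positivity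

/-- The radial profile `y ↦ g(|y⃗|²) = (|y⃗|² + R²)^{-1/2}` is smooth on `E4`. [folklore] -/
theorem contDiff_gProfile_comp {R : ℝ} (hR : 0 < R) {n : WithTop ℕ∞} :
    ContDiff ℝ n (fun y : E4 ↦ (Real.sqrt (E4.spatialNorm y ^ 2 + R ^ 2))⁻¹) :=
  (contDiff_sqrt_spatialNormSq_add hR).inv fun y ↦ (Real.sqrt_pos.mpr (by positivity)).ne'

/-- The weight `y ↦ ϖ(|y⃗|²)` is smooth on `E4`. [folklore] -/
theorem contDiff_weight_comp {R : ℝ} (hR : 0 < R) {n : WithTop ℕ∞} :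
    ContDiff ℝ n (fun y : E4 ↦ 4 * (Real.sqrt (E4.spatialNorm y ^ 2 + R ^ 2))⁻¹ +
      R ^ 2 * (Real.sqrt (E4.spatialNorm y ^ 2 + R ^ 2) ^ 3)⁻¹) := by
  have h := contDiff_sqrt_spatialNormSq_add hR (n := n)
  have hne : ∀ y : E4, Real.sqrt (E4.spatialNorm y ^ 2 + R ^ 2) ≠ 0 := fun y ↦
    (Real.sqrt_pos.mpr (by positivity)).ne'
  exact (contDiff_const.mul (h.inv hne)).add
    (contDiff_const.mul ((h.pow 3).inv fun y ↦ pow_ne_zero 3 (hne y)))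

/-- `|y⃗| ≤ √(|y⃗|² + R²)`. [folklore] -/
theorem spatialNorm_le_sqrt (R : ℝ) (y : E4) :
    E4.spatialNorm y ≤ Real.sqrt (E4.spatialNorm y ^ 2 + R ^ 2) := by
  calc E4.spatialNorm y = Real.sqrt (E4.spatialNorm y ^ 2) :=
        (Real.sqrt_sq (E4.spatialNorm_nonneg y)).symm
    _ ≤ _ := Real.sqrt_le_sqrt (by nlinarith [sq_nonneg R])

/-- `|X| ≤ 1`: `|g(|y⃗|²)| |y⃗| = |y⃗| / √(|y⃗|² + R²) ≤ 1`. [folklore] -/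
theorem abs_gProfile_mul_le (R : ℝ) (y : E4) :
    |(Real.sqrt (E4.spatialNorm y ^ 2 + R ^ 2))⁻¹| * E4.spatialNorm y ≤ 1 := by
  have ha := E4.spatialNorm_nonneg y
  have hle := spatialNorm_le_sqrt R y
  rcases eq_or_lt_of_le ha with h0 | hpos
  · rw [← h0, mul_zero]; exact zero_le_one
  · have hq : 0 < Real.sqrt (E4.spatialNorm y ^ 2 + R ^ 2) := hpos.trans_le hle
    rw [abs_of_pos (inv_pos.mpr hq), inv_mul_le_iff₀ hq, mul_one]
    exact hle

/-- `|ϖ| (|y⃗| + R) ≤ 8`: indeed `ϖ ≤ 5/q` and `(|y⃗| + R)² ≤ 2 q²`, `q = √(|y⃗|² + R²)`, so the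
square of the left side is at most `50 ≤ 64`. [folklore] -/
theorem abs_weight_mul_le {R : ℝ} (hR : 0 < R) (y : E4) :
    |4 * (Real.sqrt (E4.spatialNorm y ^ 2 + R ^ 2))⁻¹ +
        R ^ 2 * (Real.sqrt (E4.spatialNorm y ^ 2 + R ^ 2) ^ 3)⁻¹| * (E4.spatialNorm y + R) ≤ 8 := by
  set a := E4.spatialNorm y with ha_def
  have ha : 0 ≤ a := E4.spatialNorm_nonneg y
  set q := Real.sqrt (a ^ 2 + R ^ 2) with hq_def
  have hq : 0 < q := Real.sqrt_pos.mpr (by positivity)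
  have hqne : q ≠ 0 := hq.ne'
  have hq2 : q ^ 2 = a ^ 2 + R ^ 2 := Real.sq_sqrt (by positivity)
  rw [abs_of_pos (by positivity)]
  rw [show (4 * q⁻¹ + R ^ 2 * (q ^ 3)⁻¹) * (a + R) = (4 * q ^ 2 + R ^ 2) * (a + R) / q ^ 3 by
    field_simp]
  rw [div_le_iff₀ (by positivity)]
  have h1 : 4 * q ^ 2 + R ^ 2 ≤ 5 * q ^ 2 := by nlinarith [sq_nonneg a]
  have h2 : (a + R) ^ 2 ≤ 2 * q ^ 2 := by nlinarith [sq_nonneg (a - R)]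
  have h3 : ((4 * q ^ 2 + R ^ 2) * (a + R)) ^ 2 ≤ (8 * q ^ 3) ^ 2 := by
    calc ((4 * q ^ 2 + R ^ 2) * (a + R)) ^ 2 = (4 * q ^ 2 + R ^ 2) ^ 2 * (a + R) ^ 2 := by ring
      _ ≤ (5 * q ^ 2) ^ 2 * (2 * q ^ 2) := by gcongr
      _ = 50 * q ^ 6 := by ring
      _ ≤ (8 * q ^ 3) ^ 2 := by nlinarith [pow_pos hq 6]
  exact (le_abs_self _).trans (abs_le_of_sq_le_sq h3 (by positivity))

/-- `|∇ϖ| (|y⃗| + R)² ≤ 32`: the gradient of `y ↦ ϖ(|y⃗|²)` is `2 ϖ'(s) (y₁ dx¹ + y₂ dx² + y₃ dx³)`,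
of operator norm `≤ 2 |ϖ'(s)| |y⃗| ≤ 7 |y⃗| q⁻³ ≤ 7 q⁻²`, and `(|y⃗| + R)² ≤ 2 q²`. [folklore] -/
theorem norm_fderiv_weight_mul_le {R : ℝ} (hR : 0 < R) (y : E4) :
    ‖fderiv ℝ (fun z : E4 ↦ 4 * (Real.sqrt (E4.spatialNorm z ^ 2 + R ^ 2))⁻¹ +
        R ^ 2 * (Real.sqrt (E4.spatialNorm z ^ 2 + R ^ 2) ^ 3)⁻¹) y‖ *
      (E4.spatialNorm y + R) ^ 2 ≤ 32 := by
  have hs : 0 < E4.spatialNorm y ^ 2 + R ^ 2 := by positivity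
  have hd0 := (hasDerivAt_weight R hs).comp_hasFDerivAt y (KerrSchild.hasFDerivAt_spatialNormSq y)
  have hd : HasFDerivAt (fun z : E4 ↦ 4 * (Real.sqrt (E4.spatialNorm z ^ 2 + R ^ 2))⁻¹ +
        R ^ 2 * (Real.sqrt (E4.spatialNorm z ^ 2 + R ^ 2) ^ 3)⁻¹)
      ((-2 * (Real.sqrt (E4.spatialNorm y ^ 2 + R ^ 2) ^ 3)⁻¹ -
          3 / 2 * R ^ 2 * (Real.sqrt (E4.spatialNorm y ^ 2 + R ^ 2) ^ 5)⁻¹) •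
        ((2 * y 1) • E4.dx 1 + (2 * y 2) • E4.dx 2 + (2 * y 3) • E4.dx 3)) y := hd0
  rw [hd.fderiv]
  have ha2 : E4.spatialNorm y ^ 2 = y 1 ^ 2 + y 2 ^ 2 + y 3 ^ 2 := E4.spatialNorm_sq y
  have hle := spatialNorm_le_sqrt R y
  set a := E4.spatialNorm y with ha_def
  have ha : 0 ≤ a := E4.spatialNorm_nonneg y
  set q := Real.sqrt (a ^ 2 + R ^ 2) with hq_def
  have hq : 0 < q := Real.sqrt_pos.mpr hs
  have hqne : q ≠ 0 := hq.ne'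
  have hq2 : q ^ 2 = a ^ 2 + R ^ 2 := Real.sq_sqrt hs.le
  -- operator norm of the gradient
  have hop : ‖(-2 * (q ^ 3)⁻¹ - 3 / 2 * R ^ 2 * (q ^ 5)⁻¹) •
      ((2 * y 1) • E4.dx 1 + (2 * y 2) • E4.dx 2 + (2 * y 3) • E4.dx 3)‖ ≤
      (2 * (q ^ 3)⁻¹ + 3 / 2 * R ^ 2 * (q ^ 5)⁻¹) * (2 * a) := by
    refine ContinuousLinearMap.opNorm_le_bound _ (by positivity) fun v ↦ ?_
    have hv : ‖v‖ ^ 2 = v 0 ^ 2 + v 1 ^ 2 + v 2 ^ 2 + v 3 ^ 2 := by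
      rw [EuclideanSpace.real_norm_sq_eq, Fin.sum_univ_four]
    have hinner : |2 * y 1 * v 1 + 2 * y 2 * v 2 + 2 * y 3 * v 3| ≤ 2 * a * ‖v‖ := by
      refine abs_le_of_sq_le_sq ?_ (by positivity)
      have e : (2 * a * ‖v‖) ^ 2 =
          4 * (y 1 ^ 2 + y 2 ^ 2 + y 3 ^ 2) * (v 0 ^ 2 + v 1 ^ 2 + v 2 ^ 2 + v 3 ^ 2) := by
        rw [← ha2, ← hv]; ring
      rw [e]
      nlinarith [sq_nonneg (y 1 * v 2 - y 2 * v 1), sq_nonneg (y 1 * v 3 - y 3 * v 1),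
        sq_nonneg (y 2 * v 3 - y 3 * v 2),
        mul_nonneg (add_nonneg (add_nonneg (sq_nonneg (y 1)) (sq_nonneg (y 2))) (sq_nonneg (y 3)))
          (sq_nonneg (v 0))]
    have habs : |(-2 * (q ^ 3)⁻¹ - 3 / 2 * R ^ 2 * (q ^ 5)⁻¹)| =
        2 * (q ^ 3)⁻¹ + 3 / 2 * R ^ 2 * (q ^ 5)⁻¹ := by
      rw [show -2 * (q ^ 3)⁻¹ - 3 / 2 * R ^ 2 * (q ^ 5)⁻¹ =
          -(2 * (q ^ 3)⁻¹ + 3 / 2 * R ^ 2 * (q ^ 5)⁻¹) by ring, abs_neg,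
        abs_of_nonneg (by positivity)]
    simp only [_root_.add_apply, _root_.smul_apply, smul_eq_mul, PiLp.proj_apply]
    rw [Real.norm_eq_abs, abs_mul, habs]
    calc _ ≤ (2 * (q ^ 3)⁻¹ + 3 / 2 * R ^ 2 * (q ^ 5)⁻¹) * (2 * a * ‖v‖) :=
          mul_le_mul_of_nonneg_left hinner (by positivity)
      _ = _ := by ring
  -- the numerator inequality
  have hnum : (2 * q ^ 2 + 3 / 2 * R ^ 2) * (2 * a) * (a + R) ^ 2 ≤ 14 * q ^ 5 := by
    have h1 : 2 * q ^ 2 + 3 / 2 * R ^ 2 ≤ 7 / 2 * q ^ 2 := by nlinarith [sq_nonneg a]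
    have h3 : (a + R) ^ 2 ≤ 2 * q ^ 2 := by nlinarith [sq_nonneg (a - R)]
    calc (2 * q ^ 2 + 3 / 2 * R ^ 2) * (2 * a) * (a + R) ^ 2
        ≤ (7 / 2 * q ^ 2) * (2 * q) * (2 * q ^ 2) := by gcongr
      _ = 14 * q ^ 5 := by ring
  have hM : (2 * (q ^ 3)⁻¹ + 3 / 2 * R ^ 2 * (q ^ 5)⁻¹) * (2 * a) * (a + R) ^ 2 ≤ 14 := by
    rw [show (2 * (q ^ 3)⁻¹ + 3 / 2 * R ^ 2 * (q ^ 5)⁻¹) * (2 * a) * (a + R) ^ 2 =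
        (2 * q ^ 2 + 3 / 2 * R ^ 2) * (2 * a) * (a + R) ^ 2 / q ^ 5 by field_simp,
      div_le_iff₀ (by positivity)]
    exact hnum
  calc _ ≤ (2 * (q ^ 3)⁻¹ + 3 / 2 * R ^ 2 * (q ^ 5)⁻¹) * (2 * a) * (a + R) ^ 2 :=
        mul_le_mul_of_nonneg_right hop (sq_nonneg _)
    _ ≤ 14 := hM
    _ ≤ 32 := by norm_num

/-! ### The modified bulk -/

/-- The Minkowski quadratic form: `∑_{αβ} η^{αβ} p_α p_β = −p₀² + (p₁² + p₂² + p₃²)`. [folklore] -/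
theorem sum_sum_etaComp_fderiv (w : E4 → ℝ) (x : E4) :
    ∑ α, ∑ β, Kerr.etaComp α β * fderiv ℝ w x (E4.basisVector α) *
        fderiv ℝ w x (E4.basisVector β) =
      -fderiv ℝ w x (E4.basisVector 0) ^ 2 + (fderiv ℝ w x (E4.basisVector 1) ^ 2 +
        fderiv ℝ w x (E4.basisVector 2) ^ 2 + fderiv ℝ w x (E4.basisVector 3) ^ 2) := by
  obtain ⟨p, hp⟩ : ∃ p : Fin 4 → ℝ, ∀ κ, fderiv ℝ w x (E4.basisVector κ) = p κ :=
    ⟨_, fun _ ↦ rfl⟩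
  simp only [hp, KerrSchild.etaComp_eq, Fin.sum_univ_four, Fin.isValue]
  simp only [show (1 : Fin 4) ≠ 0 from by decide, show (2 : Fin 4) ≠ 0 from by decide,
    show (3 : Fin 4) ≠ 0 from by decide, show (0 : Fin 4) ≠ 1 from by decide,
    show (0 : Fin 4) ≠ 2 from by decide, show (0 : Fin 4) ≠ 3 from by decide,
    show (1 : Fin 4) ≠ 2 from by decide, show (1 : Fin 4) ≠ 3 from by decide,
    show (2 : Fin 4) ≠ 1 from by decide, show (2 : Fin 4) ≠ 3 from by decide,
    show (3 : Fin 4) ≠ 1 from by decide, show (3 : Fin 4) ≠ 2 from by decide, if_true, if_false]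
  ring

/-- **Lower bound for the modified bulk of the flat KSS pair.** With `q = √(|y⃗|² + R²)`,
`g = q⁻¹`, `ϖ = 4 q⁻¹ + R² q⁻³` and `p_μ = ∂_μ w(x)`:
`K^X + ¼ ϖ ∑ η^{αβ} p_α p_β − ⅛ (□_η ϖ) w² ≥ ¼ R² q⁻³ ∑_μ p_μ²`; in fact the left side equals
`q⁻³ ((s|p⃗|² − (y⃗·p⃗)²) + ¾ R² |p⃗|² + ¼ R² p₀²) + (R²/8) q⁻⁷ (6s + 21R²) w²`. [folklore] -/
theorem bulk_lower_bound {R : ℝ} (hR : 0 < R) {g ϖ : ℝ → ℝ}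
    (hg : g = fun u ↦ (Real.sqrt (u + R ^ 2))⁻¹)
    (hϖ : ϖ = fun u ↦ 4 * (Real.sqrt (u + R ^ 2))⁻¹ + R ^ 2 * (Real.sqrt (u + R ^ 2) ^ 3)⁻¹)
    (w : E4 → ℝ) (x : E4) :
    4⁻¹ * R ^ 2 * (Real.sqrt (E4.spatialNorm x ^ 2 + R ^ 2) ^ 3)⁻¹ *
        ∑ μ : Fin 4, (fderiv ℝ w x (E4.basisVector μ)) ^ 2 ≤
      KerrSchild.multiplierBulk (fun _ ↦ Kerr.etaComp)
          (fun y α ↦ if α = 0 then (0 : ℝ) else g (E4.spatialNorm y ^ 2) * y α) w x +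
        4⁻¹ * (ϖ (E4.spatialNorm x ^ 2) * ∑ α, ∑ β, Kerr.etaComp α β *
          fderiv ℝ w x (E4.basisVector α) * fderiv ℝ w x (E4.basisVector β)) -
        8⁻¹ * KerrSchild.waveOperator (fun _ ↦ Kerr.etaComp)
          (fun y ↦ ϖ (E4.spatialNorm y ^ 2)) x * w x ^ 2 := by
  have hs : 0 < E4.spatialNorm x ^ 2 + R ^ 2 := by positivity
  -- the calculus inputs
  have hg' : HasDerivAt g (-(1 / 2) * (Real.sqrt (E4.spatialNorm x ^ 2 + R ^ 2) ^ 3)⁻¹)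
      (E4.spatialNorm x ^ 2) := hg ▸ hasDerivAt_gProfile R hs
  have hϖ2 : ContDiffAt ℝ 2 ϖ (E4.spatialNorm x ^ 2) := hϖ ▸ contDiffAt_weight R hs
  have hgx : g (E4.spatialNorm x ^ 2) = (Real.sqrt (E4.spatialNorm x ^ 2 + R ^ 2))⁻¹ := by
    rw [hg]
  have hϖx : ϖ (E4.spatialNorm x ^ 2) = 4 * (Real.sqrt (E4.spatialNorm x ^ 2 + R ^ 2))⁻¹ +
      R ^ 2 * (Real.sqrt (E4.spatialNorm x ^ 2 + R ^ 2) ^ 3)⁻¹ := by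
    rw [hϖ]
  have hd1 : deriv ϖ (E4.spatialNorm x ^ 2) =
      -2 * (Real.sqrt (E4.spatialNorm x ^ 2 + R ^ 2) ^ 3)⁻¹ -
        3 / 2 * R ^ 2 * (Real.sqrt (E4.spatialNorm x ^ 2 + R ^ 2) ^ 5)⁻¹ := by
    rw [hϖ]
    exact deriv_weight R hs
  have hd2 : deriv (deriv ϖ) (E4.spatialNorm x ^ 2) =
      3 * (Real.sqrt (E4.spatialNorm x ^ 2 + R ^ 2) ^ 5)⁻¹ +
        15 / 4 * R ^ 2 * (Real.sqrt (E4.spatialNorm x ^ 2 + R ^ 2) ^ 7)⁻¹ := by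
    rw [hϖ]
    exact deriv_deriv_weight R hs
  rw [KerrSchild.multiplierBulk_eta_radial w hg', KerrSchild.waveOperator_eta_radial hϖ2, hd2, hd1,
    hϖx, hgx, sum_sum_etaComp_fderiv w x, Fin.sum_univ_four]
  -- name the atoms
  obtain ⟨p, hp⟩ : ∃ p : Fin 4 → ℝ, ∀ κ, fderiv ℝ w x (E4.basisVector κ) = p κ :=
    ⟨_, fun _ ↦ rfl⟩
  simp only [hp]
  obtain ⟨W, hW⟩ : ∃ W, w x = W := ⟨_, rfl⟩
  rw [hW]
  have hS3 : x 1 ^ 2 + x 2 ^ 2 + x 3 ^ 2 = E4.spatialNorm x ^ 2 := (E4.spatialNorm_sq x).symm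
  obtain ⟨S, hS⟩ : ∃ S, E4.spatialNorm x ^ 2 = S := ⟨_, rfl⟩
  rw [hS] at hS3 hs ⊢
  have hQpos : 0 < Real.sqrt (S + R ^ 2) := Real.sqrt_pos.mpr hs
  have hQsq : Real.sqrt (S + R ^ 2) ^ 2 = S + R ^ 2 := Real.sq_sqrt hs.le
  obtain ⟨Q, hQ⟩ : ∃ Q, Real.sqrt (S + R ^ 2) = Q := ⟨_, rfl⟩
  rw [hQ] at hQpos hQsq ⊢
  obtain rfl : S = Q ^ 2 - R ^ 2 := by linarith
  have hQne : Q ≠ 0 := hQpos.ne'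
  -- Cauchy–Schwarz `(y⃗·p⃗)² ≤ s |p⃗|²`
  have hCS : 0 ≤ (Q ^ 2 - R ^ 2) * (p 1 ^ 2 + p 2 ^ 2 + p 3 ^ 2) -
      (x 1 * p 1 + x 2 * p 2 + x 3 * p 3) ^ 2 := by
    rw [← hS3]
    nlinarith [sq_nonneg (x 1 * p 2 - x 2 * p 1), sq_nonneg (x 1 * p 3 - x 3 * p 1),
      sq_nonneg (x 2 * p 3 - x 3 * p 2)]
  have key : 0 ≤ (Q ^ 3)⁻¹ * (((Q ^ 2 - R ^ 2) * (p 1 ^ 2 + p 2 ^ 2 + p 3 ^ 2) -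
      (x 1 * p 1 + x 2 * p 2 + x 3 * p 3) ^ 2) + 2⁻¹ * R ^ 2 * (p 1 ^ 2 + p 2 ^ 2 + p 3 ^ 2)) +
      8⁻¹ * R ^ 2 * (Q ^ 7)⁻¹ * (6 * Q ^ 2 + 15 * R ^ 2) * W ^ 2 :=
    add_nonneg (mul_nonneg (by positivity) (add_nonneg hCS (by positivity))) (by positivity)
  rw [← sub_nonneg]
  convert key using 1
  field_simp
  ring

/-- **A smooth lab-centred KSS multiplier on Minkowski space.** For every `R > 0` there are smooth
radial profiles `g, ϖ` (functions of `s = |y⃗|²`; `X⁰ = 0`, `Xⁱ = g(s) yᵢ`, Lagrangian weight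
`ϖ(s)`) with `|X| ≤ 1`, `|ϖ| ≤ 8/(|y⃗| + R)`, `|∇ϖ| ≤ 32/(|y⃗| + R)²`, whose modified bulk
`K^X + ¼ ϖ η(dw, dw) − ⅛ (□_η ϖ) w²` is everywhere `≥ 0` and `≥ c₀ ∑_μ (∂_μ w)²` on `{|y⃗| ≤ R}`:
`g = (s + R²)^{-1/2}`, `ϖ = (4s + 5R²)(s + R²)^{-3/2} = 2 div X − R² g³`, `c₀ = (32 R)⁻¹`; the
bulk is `≥ ¼ R² (s + R²)^{-3/2} ∑_μ (∂_μ w)²` (`bulk_lower_bound`) and `(s + R²)^{3/2} ≤ 8 R³` on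
the ball. [folklore] -/
theorem stub_flatMorawetzBulk :
    ∀ R : ℝ, 0 < R → ∃ (g ϖ : ℝ → ℝ) (c₀ : ℝ), 0 < c₀ ∧
      ContDiff ℝ ∞ (fun y : E4 ↦ g (E4.spatialNorm y ^ 2)) ∧
      ContDiff ℝ ∞ (fun y : E4 ↦ ϖ (E4.spatialNorm y ^ 2)) ∧
      (∀ y : E4, |g (E4.spatialNorm y ^ 2)| * E4.spatialNorm y ≤ 1) ∧
      (∀ y : E4, |ϖ (E4.spatialNorm y ^ 2)| * (E4.spatialNorm y + R) ≤ 8) ∧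
      (∀ y : E4, ‖fderiv ℝ (fun z : E4 ↦ ϖ (E4.spatialNorm z ^ 2)) y‖ *
        (E4.spatialNorm y + R) ^ 2 ≤ 32) ∧
      (∀ (w : E4 → ℝ) (x : E4),
        0 ≤ KerrSchild.multiplierBulk (fun _ ↦ Kerr.etaComp)
            (fun y α ↦ if α = 0 then (0 : ℝ) else g (E4.spatialNorm y ^ 2) * y α) w x +
          4⁻¹ * (ϖ (E4.spatialNorm x ^ 2) * ∑ α, ∑ β, Kerr.etaComp α β *
            fderiv ℝ w x (E4.basisVector α) * fderiv ℝ w x (E4.basisVector β)) -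
          8⁻¹ * KerrSchild.waveOperator (fun _ ↦ Kerr.etaComp)
            (fun y ↦ ϖ (E4.spatialNorm y ^ 2)) x * w x ^ 2) ∧
      (∀ (w : E4 → ℝ) (x : E4), E4.spatialNorm x ≤ R →
        c₀ * ∑ μ : Fin 4, (fderiv ℝ w x (E4.basisVector μ)) ^ 2 ≤
          KerrSchild.multiplierBulk (fun _ ↦ Kerr.etaComp)
            (fun y α ↦ if α = 0 then (0 : ℝ) else g (E4.spatialNorm y ^ 2) * y α) w x +
          4⁻¹ * (ϖ (E4.spatialNorm x ^ 2) * ∑ α, ∑ β, Kerr.etaComp α β *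
            fderiv ℝ w x (E4.basisVector α) * fderiv ℝ w x (E4.basisVector β)) -
          8⁻¹ * KerrSchild.waveOperator (fun _ ↦ Kerr.etaComp)
            (fun y ↦ ϖ (E4.spatialNorm y ^ 2)) x * w x ^ 2) := by
  intro R hR
  refine ⟨fun u ↦ (Real.sqrt (u + R ^ 2))⁻¹,
    fun u ↦ 4 * (Real.sqrt (u + R ^ 2))⁻¹ + R ^ 2 * (Real.sqrt (u + R ^ 2) ^ 3)⁻¹,
    (32 * R)⁻¹, by positivity, contDiff_gProfile_comp hR, contDiff_weight_comp hR,
    abs_gProfile_mul_le R, abs_weight_mul_le hR, norm_fderiv_weight_mul_le hR, ?_, ?_⟩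
  · intro w x
    exact le_trans (by positivity) (bulk_lower_bound hR rfl rfl w x)
  · intro w x hx
    refine le_trans ?_ (bulk_lower_bound hR rfl rfl w x)
    refine mul_le_mul_of_nonneg_right ?_ (Finset.sum_nonneg fun μ _ ↦ sq_nonneg _)
    have ha := E4.spatialNorm_nonneg x
    have hq : 0 < Real.sqrt (E4.spatialNorm x ^ 2 + R ^ 2) := Real.sqrt_pos.mpr (by positivity)
    have hqle : Real.sqrt (E4.spatialNorm x ^ 2 + R ^ 2) ≤ 2 * R := by
      rw [Real.sqrt_le_left (by positivity)]
      nlinarith [mul_nonneg (sub_nonneg.mpr hx) (add_nonneg hR.le ha)]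
    have hq3 : Real.sqrt (E4.spatialNorm x ^ 2 + R ^ 2) ^ 3 ≤ (2 * R) ^ 3 :=
      pow_le_pow_left₀ hq.le hqle 3
    rw [show 4⁻¹ * R ^ 2 * (Real.sqrt (E4.spatialNorm x ^ 2 + R ^ 2) ^ 3)⁻¹ =
        R ^ 2 / (4 * Real.sqrt (E4.spatialNorm x ^ 2 + R ^ 2) ^ 3) by ring,
      show (32 * R)⁻¹ = 1 / (32 * R) by ring, div_le_div_iff₀ (by positivity) (by positivity)]
    nlinarith [hq3, pow_pos hR 3]

end Summit.FinalStateConjecture.FinalStateConjecture.Cruxes.AdiabaticMultiKerrILED.Sketch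

end
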